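/-
Copyright (c) 2026. All rights reserved.
Released under Apache 2.0 license as described in the file LICENSE.
-/
import Mathlib
import HarnessLib

/-!
# G decomposition continuity lemmas for CombDescentStep

Continuity of pole sum terms needed for the G decomposition limit argument.
These lemmas support the limit: G(c) = lim_{z→c} G(z) = pole_sum(c) + O(η/s).
-/

open Complex Real Set Filter Topology Metric
open scoped BigOperators Topology ComplexConjugate

noncomputable section

namespace EarlyAppointmentsGDecompContinuity

/-- c - conj(c) ≠ 0 when h > 0. -/
theorem c_sub_conj_ne_zero {x₀ h : ℝ} (hh : 0 < h) :
    ((x₀ : ℂ) + h * I) - ((x₀ : ℂ) - h * I) ≠ 0 := by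
  have heq : ((x₀ : ℂ) + h * I) - ((x₀ : ℂ) - h * I) = 2 * h * I := by ring
  rw [heq]
  have h2ne : (2 : ℂ) ≠ 0 := by norm_num
  have hhne : (h : ℂ) ≠ 0 := ofReal_ne_zero.mpr (ne_of_gt hh)
  exact mul_ne_zero (mul_ne_zero h2ne hhne) I_ne_zero

/-- c - ξ ≠ 0 for real ξ when c has positive imaginary part. -/
theorem c_sub_real_ne_zero {x₀ h : ℝ} (hh : 0 < h) (ξ : ℝ) :
    ((x₀ : ℂ) + h * I) - (ξ : ℂ) ≠ 0 := by
  simp only [ne_eq, sub_eq_zero]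
  intro heq
  have him : ((x₀ : ℂ) + h * I).im = (ξ : ℂ).im := congrArg im heq
  simp only [add_im, ofReal_im, mul_im, ofReal_re, I_im, mul_one, I_re, mul_zero, add_zero,
    ofReal_im] at him
  linarith

/-- The conjugate pole term 1/(z - conj(c)) is continuous at c. -/
theorem continuousAt_inv_sub_conj {x₀ h : ℝ} (hh : 0 < h) :
    let c := (x₀ : ℂ) + h * I
    ContinuousAt (fun z => 1 / (z - ((x₀ : ℂ) - h * I))) c := by
  intro c
  have hne : c - ((x₀ : ℂ) - h * I) ≠ 0 := c_sub_conj_ne_zero hh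
  exact continuousAt_const.div (continuousAt_id.sub continuousAt_const) hne

/-- Each real pole term 1/(z - ξ) is continuous at c = x₀ + ih. -/
theorem continuousAt_inv_sub_real {x₀ h : ℝ} (hh : 0 < h) (ξ : ℝ) :
    let c := (x₀ : ℂ) + h * I
    ContinuousAt (fun z => 1 / (z - (ξ : ℂ))) c := by
  intro c
  have hne : c - (ξ : ℂ) ≠ 0 := c_sub_real_ne_zero hh ξ
  exact continuousAt_const.div (continuousAt_id.sub continuousAt_const) hne

/-- The pole sum F(z) = 1/(z - conj c) + Σ_ξ 1/(z - ξ) is continuous at c.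
    (For a finite set of poles; infinite case requires more care.) -/
theorem continuousAt_pole_sum_finite {x₀ h : ℝ} (hh : 0 < h) (S : Finset ℝ) :
    let c := (x₀ : ℂ) + h * I
    ContinuousAt (fun z => 1 / (z - ((x₀ : ℂ) - h * I)) + ∑ ξ ∈ S, 1 / (z - (ξ : ℂ))) c := by
  intro c
  apply ContinuousAt.add
  · exact continuousAt_inv_sub_conj hh
  · -- ContinuousAt of finite sum follows from ContinuousAt of each term
    -- Use induction on S
    induction S using Finset.induction with
    | empty => simp only [Finset.sum_empty]; exact continuousAt_const
    | @insert ξ S' hξ ih =>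
      simp only [Finset.sum_insert hξ]
      exact (continuousAt_inv_sub_real hh ξ).add ih

end EarlyAppointmentsGDecompContinuity

end
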